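import Literature.NumberTheory.PAdicHodge.BdRPlusFormalLogModFil
import Literature.NumberTheory.PAdicHodge.AinfWeierstrassKummerIntegral
import HarnessLib

/-!
# On `Ŵ(ker θ)` the `ξ`-adic formal logarithm of K1 IS the `p`-adic one: `∫_t ω` and `log_W` of `[ũ] ⊖ Q` are values of `log_W mod Fil^k`

Topic `Literature/NumberTheory/PAdicHodge`; namespace `Literature.NumberTheory.PAdicHodge.GaloisContinuity`. THEOREMS ONLY (no definition, no instance,
no named fact, no `sorry`). The junction between K1's `ξ`-ADIC evaluation of `log_W` on `Ŵ(ξ𝔸_inf) = Ŵ(ker θ)` (`LubinTate.evalPt₁` on `BdRPlusTop.filOne`: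
`AinfTop.omegaPeriod` = `∫_t ω`, `AinfTop.logKer`, files `AinfWeierstrassOmegaPeriod`, `AinfWeierstrassKummerIntegral`) and this seat's `p`-ADIC
evaluation `IsFormalLogModFil W k x L` («`L = log_W(ι x) mod Fil^k`», `BdRPlusFormalLogModFil`) — the elliptic twin of `isLogModFil_logOneAdd`:

* ★ `isFormalLogModFil_evalPt₁` — for `z ∈ ξ𝔸_inf`, K1's `ξ`-adic value `evalPt₁ filOne (logSeries W) (ι z)` is a value of `log_W(ι z)` modulo
  EVERY `Fil^k` (its difference with the `M`-th partial sum lies in `Fil^{M+1}`);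
* ★ `isFormalLogModFil_omegaPeriod` — `∫_t ω = log_W([t])` (K1) is a value of `log_W(ι[t]) mod Fil^k` for every `t ∈ T_pŴ`;
* ★ `isFormalLogModFil_logKer` — the same for K1's `logKer z` on points `z ∈ Ŵ(𝔫)` with `θ(z) = 0`.

With `IsFormalLogModFil.addW` (additivity) this lets the `p`-adic `log_W(ι[ũ]) mod Fil^k` of Fontaine's integral `[ũ]` inherit K1's `ξ`-adic identities
(`(σ−1)[ũ] = [κ(σ)]` ⟹ `(σ−1) log_W(ι[ũ]) ≡ ∫_{κ(σ)} ω`), while `θ(log_W(ι[ũ])) = log_ω(P)` (`IsFormalLogModFil.thetaBdR_eq_of_tendsto`) — floor (H4) step (3)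
of `Summits/…/Cruxes/StarredOptimalManinUnitFiveSeven/Lines/kato-lever-K3-B2-road.md` (crux K★ `stmt-BirchSwinnertonDyer-22226`). Infrastructure only;
BSD / K★ are not proved by any of this.

## References
* J.-M. Fontaine, *Formes différentielles et modules de Tate…*, Invent. Math. 65 (1982), §5. [Fontaine1982FormesDifferentielles]
* J.-M. Fontaine, *Le corps des périodes p-adiques*, Astérisque 223 (1994), Exp. II §1.5.4. [FontaineAsterisque223III]
-/

noncomputable section

namespace Literature.NumberTheory.PAdicHodge

namespace GaloisContinuity

open ValuativeRel Field Ideal WittVector Finset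
open Literature.NumberTheory.GaloisRepresentations Literature.NumberTheory.GaloisRepresentations.IsNonarchimedeanLocalField
open Literature.NumberTheory.GaloisRepresentations.LubinTate

variable {F : Type} [Field F] [ValuativeRel F] [TopologicalSpace F] [IsNonarchimedeanLocalField F]
  [CharZero F] {p : ℕ} [Fact p.Prime] [Fact (¬ IsUnit (p : integerC F))]
  [IsAdicComplete (Ideal.span {(p : integerC F)}) (integerC F)]

omit [CharZero F] in
/-- The `M`-th partial sum of `log_W` at `ι z`, read in `BdRPlusTop`, is the truncation `trunc_{M+1}(log_W)` evaluated at `ofAinf z`.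
[cite: Fontaine1982FormesDifferentielles, §5] -/
theorem of_logTypePartialSum_formalLogNum (W : WeierstrassCurve ℤ) (z : Ainf (p := p) F) (M : ℕ) :
    BdRPlusTop.of F p (logTypePartialSum (formalLogNum W p) z M) =
      Polynomial.aeval (BdRPlusTop.ofAinf F p z) (PowerSeries.trunc (M + 1) (AinfTop.logSeries W)) := by
  rw [logTypePartialSum_eq_sum_algebraMap (formalLogNum_div_eq W), Polynomial.aeval_def, PowerSeries.eval₂_trunc_eq_sum_range,
    Finset.sum_range_succ', map_sum]
  have h0 : (algebraMap RatCoeff (BdRPlusTop F p)) (PowerSeries.coeff 0 (AinfTop.logSeries W)) * BdRPlusTop.ofAinf F p z ^ 0 = 0 := by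
    rw [PowerSeries.coeff_zero_eq_constantCoeff, AinfTop.constantCoeff_logSeries, map_zero, zero_mul]
  rw [h0, add_zero]
  refine Finset.sum_congr rfl fun m _ => ?_
  rw [map_mul, map_pow, AinfTop.logSeries, PowerSeries.coeff_map, BdRPlusTop.algebraMap_ratCoeff, RingEquiv.toRingHom_eq_coe, RingHom.coe_coe,
    RingEquiv.symm_apply_apply]
  rfl

/-- ★ **K1's `ξ`-adic `log_W` is a `p`-adic value modulo every `Fil^k`.** For `z ∈ ξ𝔸_inf` the element
`evalPt₁ filOne (logSeries W) (ι z)` (the `ξ`-adic evaluation of `log_W`, K1) satisfies `IsFormalLogModFil W k z ·` for all `k`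
(`log_W(ι z) − P_M(z) ∈ Fil^{M+1}`). [cite: Fontaine1982FormesDifferentielles, §5] [cite: FontaineAsterisque223III, Exp. II §1.5.4] -/
theorem isFormalLogModFil_evalPt₁ (W : WeierstrassCurve ℤ) (k : ℕ) {z : Ainf (p := p) F} (hz : z ∈ Ideal.span {(xi : Ainf (p := p) F)}) :
    IsFormalLogModFil W k z ((BdRPlusTop.of F p).symm (evalPt₁ (BdRPlusTop.filOne F p) (AinfTop.logSeries W) (AinfTop.constantCoeff_logSeries W)
      ⟨BdRPlusTop.ofAinf F p z, BdRPlusTop.ofAinf_mem_filOne hz⟩ : BdRPlusTop F p)) := by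
  set x : (BdRPlusTop.filOne F p).toIdeal := ⟨BdRPlusTop.ofAinf F p z, BdRPlusTop.ofAinf_mem_filOne hz⟩ with hx
  have hxt : IsTopologicallyNilpotent (x : BdRPlusTop F p) := (BdRPlusTop.filOne F p).isTopologicallyNilpotent _ x.2
  -- `log_W(ι z) − P_M(z) ∈ Fil^{M+1}`
  have key : ∀ M : ℕ, (evalPt₁ (BdRPlusTop.filOne F p) (AinfTop.logSeries W) (AinfTop.constantCoeff_logSeries W) x : BdRPlusTop F p) -
      BdRPlusTop.of F p (logTypePartialSum (formalLogNum W p) z M) ∈ (BdRPlusTop.filOne F p).toIdeal ^ (M + 1) := by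
    intro M
    set q : Polynomial RatCoeff := PowerSeries.trunc (M + 1) (AinfTop.logSeries W) with hq
    have hval : (evalPt₁ (BdRPlusTop.filOne F p) (AinfTop.logSeries W) (AinfTop.constantCoeff_logSeries W) x : BdRPlusTop F p) -
        BdRPlusTop.of F p (logTypePartialSum (formalLogNum W p) z M) = PowerSeries.aeval hxt (AinfTop.logSeries W - (q : PowerSeries RatCoeff)) := by
      rw [map_sub, PowerSeries.aeval_coe, hq, of_logTypePartialSum_formalLogNum]
      rfl
    rw [hval]
    have hclosed : IsClosed (((BdRPlusTop.filOne F p).toIdeal ^ (M + 1) : Ideal (BdRPlusTop F p)) : Set (BdRPlusTop F p)) :=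
      BdRPlusTop.isClosed_of_pow_le le_rfl
    refine hclosed.mem_of_tendsto (PowerSeries.hasSum_aeval hxt _) (Filter.Eventually.of_forall fun T => ?_)
    refine Ideal.sum_mem _ fun d _ => ?_
    by_cases hd : d < M + 1
    · rw [map_sub, Polynomial.coeff_coe, hq, PowerSeries.coeff_trunc, if_pos hd, sub_self, zero_smul]
      exact Ideal.zero_mem _
    · rw [Algebra.smul_def]
      exact Ideal.mul_mem_left _ _ (Ideal.pow_le_pow_right (by omega) (Ideal.pow_mem_pow x.2 d))
  intro j
  refine ⟨k, fun M hM => ?_⟩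
  have h := Ideal.pow_le_pow_right (show k ≤ M + 1 by omega) (key M)
  rw [BdRPlusTop.mem_filOne_pow_iff, map_sub, RingEquiv.symm_apply_apply] at h
  obtain ⟨c, hc⟩ := Ideal.mem_span_singleton'.1 (Ideal.span_singleton_pow (xiBdR : BDeRhamPlus (integerC F) p) k ▸ h)
  exact ⟨0, c, by rw [mul_zero, map_zero, zero_add, mul_comm, hc]⟩

variable {hθ : Function.Surjective (fontaineTheta (integerC F) p)}

/-- ★ **`∫_t ω = log_W([t])` is a value of `log_W(ι[t]) mod Fil^k`** for every Tate-module sequence `t` of `Ŵ(𝒪_{ℂ_F})` (K1's `AinfTop.omegaPeriod`).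
[cite: Fontaine1982FormesDifferentielles, §5] -/
theorem isFormalLogModFil_omegaPeriod (W : WeierstrassCurve ℤ) (k : ℕ) {t : ℕ → (maxNilIdealC F).toIdeal} (ht0 : (t 0 : CBall F) = 0)
    (htp : ∀ n, AinfTop.mulPC F p W (t (n + 1)) = t n) :
    IsFormalLogModFil W k ((AinfTop.of F p).symm (AinfTop.torsionLift W hθ t htp))
      ((BdRPlusTop.of F p).symm (AinfTop.omegaPeriod W hθ t ht0 htp)) :=
  isFormalLogModFil_evalPt₁ W k (AinfTop.torsionLift_mem_span_xi W ht0 htp)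

/-- ★ **K1's `logKer z` is a value of `log_W(ι z) mod Fil^k`** for every point `z ∈ Ŵ(𝔫)` with `θ(z) = 0`. [cite: Fontaine1982FormesDifferentielles, §5] -/
theorem isFormalLogModFil_logKer (W : WeierstrassCurve ℤ) (k : ℕ) (z : W.Pt (AinfTop.nilTheta F p hθ)) (hz : AinfTop.thetaPt W hθ z = 0) :
    IsFormalLogModFil W k ((AinfTop.of F p).symm (z.val : AinfTop F p)) ((BdRPlusTop.of F p).symm (AinfTop.logKer W z hz)) :=
  isFormalLogModFil_evalPt₁ W k (AinfTop.mem_span_xi_of_thetaPt_eq_zero W z hz)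

end GaloisContinuity

end Literature.NumberTheory.PAdicHodge

end
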